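import Summits.ValiantsHypothesis.ValiantsHypothesis.Theorems.SymPencilBoxFourFiltration
import Summits.ValiantsHypothesis.ValiantsHypothesis.Theorems.SymPencilBoxFourGraph
import Summits.ValiantsHypothesis.ValiantsHypothesis.Theorems.SymPencilBoxFourToric

/-!
# Route `SymPencil` — the BoxFour equality case: `8`-dimensional spaces of `4 × 4` matrices with
# vanishing `3 × 3` subpermanents are "two zero rows" or "two zero columns"
# (`--supports` stmt-ValiantsHypothesis-5674 `SdcSuperquadratic`; rung `sdc(per_4) ≥ 21`)

**Theorem** (`two_rows_or_two_cols`, `two_rows_or_two_cols_of_subperm_three_vanish`).  Over a field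
of characteristic `0`, let `W` be a linear subspace of `4 × 4` matrices with `dim W = 8` on which
all sixteen `3 × 3` subpermanents vanish (equivalently `W ⊆ Sing Z(per_4)`, the equality case of
`AlperBogartVelascoBoxFour.finrank_le_eight_of_subperm_three_vanish`).  Then there are two rows
`a ≠ b` vanishing identically on `W`, or two columns `a ≠ b` vanishing identically on `W` (so `W`
is exactly the space of matrices supported in the other two rows, resp. columns).

Proof (files `SymPencilBoxFourProfile/Filtration/Graph/Toric`).  If some pair of rows detects `W`,
`SymPencilBoxFourGraph` gives two zero rows; if some pair of columns detects `W`, transpose.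
Otherwise every row order has profile `(2,2,2,2)` (`SymPencilBoxFourFiltration`), so `W` is stable
under keeping a single row and every row of `W` is `2`-dimensional
(`SymPencilBoxFourToric.rowPiece_mem_of_finrank`), and the same for columns via the transpose;
`SymPencilBoxFourToric.false_of_row_col_stable` then exhibits a `3 × 3` subpermanent equal to `1`.

Context: von zur Gathen (1987) states that the components of `Sing Z(per_4)` have dimension `6`
or `8` (quoted in Landsberg, *Geometry and Complexity Theory* (2017), §6.3.3, without proof); the
linear `8`-dimensional ones are classified here by elementary linear algebra.  Use: the kernel-row
space `V = ker b` of a symmetric determinantal representation of `per_4` of size `m ≤ 20` with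
`dim V = 8` (`SymPencilSdcPerFourTwentyOne`).  Nothing here bears on `VP ≠ VNP`. [folklore]
-/

noncomputable section

-- single-conjunct layout: Sub = Summit, duplicated namespace component intended
set_option linter.dupNamespace false

namespace Summit.ValiantsHypothesis.ValiantsHypothesis.Theorems.SymPencilBoxFourEquality

open Module Finset
open Literature.Computability.AlgebraicComplexity
open Literature.Computability.AlgebraicComplexity.AlperBogartVelasco
open Summit.ValiantsHypothesis.ValiantsHypothesis.Theorems.SymPencilBoxFourFiltration
open Summit.ValiantsHypothesis.ValiantsHypothesis.Theorems.SymPencilBoxFourGraph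
open Summit.ValiantsHypothesis.ValiantsHypothesis.Theorems.SymPencilBoxFourToric

variable {K : Type*} [Field K]

/-- The hypothesis "all `3 × 3` minor-permanents on injective index maps vanish" passes to the
transposed space. [folklore] -/
theorem subperm_vanish_transpose (W : Submodule K (Fin 4 × Fin 4 → K))
    (hW : ∀ x ∈ W, ∀ (r c : Fin 3 → Fin 4), Function.Injective r → Function.Injective c →
      ((Matrix.of fun i j => x (i, j)).submatrix r c).permanent = 0) :
    ∀ y ∈ W.map (LinearEquiv.funCongrLeft K K (Equiv.prodComm (Fin 4) (Fin 4))).toLinearMap,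
      ∀ (r c : Fin 3 → Fin 4), Function.Injective r → Function.Injective c →
      ((Matrix.of fun i j => y (i, j)).submatrix r c).permanent = 0 := by
  rintro _ ⟨x, hx, rfl⟩ r c hr hc
  have h : (Matrix.of fun i j =>
      (LinearEquiv.funCongrLeft K K (Equiv.prodComm (Fin 4) (Fin 4))).toLinearMap x (i, j)).submatrix
        r c = Matrix.transpose ((Matrix.of fun i j => x (i, j)).submatrix c r) := by
    ext i j
    rfl
  rw [h, Matrix.permanent_transpose]
  exact hW x hx c r hc hr

/-- Injective maps `Fin 3 → Fin 4` factor through a `succAbove`. [folklore] -/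
theorem exists_succAbove_comp_of_injective :
    ∀ r : Fin 3 → Fin 4, Function.Injective r →
      ∃ s : Fin 4, ∃ τ : Equiv.Perm (Fin 3), r = s.succAbove ∘ τ := by
  decide

/-- From the sixteen `3 × 3` subpermanents (rows/columns `≠ r, c`) to all `3 × 3` minor-permanents
on injective index maps. [folklore] -/
theorem subperm_vanish_inj_of_succAbove (x : Fin 4 × Fin 4 → K)
    (hx : ∀ r c : Fin 4,
      ((Matrix.of fun i j => x (i, j)).submatrix r.succAbove c.succAbove).permanent = 0)
    (r c : Fin 3 → Fin 4) (hr : Function.Injective r) (hc : Function.Injective c) :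
    ((Matrix.of fun i j => x (i, j)).submatrix r c).permanent = 0 := by
  obtain ⟨s, τ, rfl⟩ := exists_succAbove_comp_of_injective r hr
  obtain ⟨s', τ', rfl⟩ := exists_succAbove_comp_of_injective c hc
  have h : (Matrix.of fun i j => x (i, j)).submatrix (s.succAbove ∘ ⇑τ) (s'.succAbove ∘ ⇑τ') =
      (((Matrix.of fun i j => x (i, j)).submatrix s.succAbove s'.succAbove).submatrix ⇑τ id).submatrix
        id ⇑τ' := by
    ext i j
    rfl
  rw [h, Matrix.permanent_permute_rows, Matrix.permanent_permute_cols]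
  exact hx s s'

/-- **The BoxFour equality case.**  An `8`-dimensional space of `4 × 4` matrices (characteristic
`0`) on which all `3 × 3` minor-permanents vanish has two identically vanishing rows or two
identically vanishing columns. [folklore] -/
theorem two_rows_or_two_cols [CharZero K] (W : Submodule K (Fin 4 × Fin 4 → K))
    (hW : ∀ x ∈ W, ∀ (r c : Fin 3 → Fin 4), Function.Injective r → Function.Injective c →
      ((Matrix.of fun i j => x (i, j)).submatrix r c).permanent = 0)
    (h8 : finrank K W = 8) :
    (∃ a b : Fin 4, a ≠ b ∧ ∀ x ∈ W, ∀ j, x (a, j) = 0 ∧ x (b, j) = 0) ∨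
    (∃ a b : Fin 4, a ≠ b ∧ ∀ x ∈ W, ∀ i, x (i, a) = 0 ∧ x (i, b) = 0) := by
  have hcases : ∀ i : Fin 4, i = 0 ∨ i = 1 ∨ i = 2 ∨ i = 3 := by decide
  have hother : ∀ p q : Fin 4, p ≠ q → ∃ a b : Fin 4, a ≠ b ∧ a ≠ p ∧ a ≠ q ∧ b ≠ p ∧ b ≠ q := by
    decide
  -- the transposed space
  set τ := (LinearEquiv.funCongrLeft K K (Equiv.prodComm (Fin 4) (Fin 4))) with hτ
  have hτa : ∀ (x : Fin 4 × Fin 4 → K) i j, τ x (i, j) = x (j, i) := fun x i j => rfl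
  set W' := W.map τ.toLinearMap with hW'def
  have hW' := subperm_vanish_transpose W hW
  rw [← hτ, ← hW'def] at hW'
  have h8' : finrank K W' = 8 := by rw [hW'def, LinearEquiv.finrank_map_eq, h8]
  have memW' : ∀ x, x ∈ W → τ x ∈ W' := fun x hx => ⟨x, hx, rfl⟩
  have memW'' : ∀ y, y ∈ W' → τ.symm y ∈ W := by
    rintro _ ⟨x, hx, rfl⟩
    rw [LinearEquiv.coe_toLinearMap, LinearEquiv.symm_apply_apply]
    exact hx
  by_cases hG : ∃ p q : Fin 4, p ≠ q ∧ ∀ x ∈ W, (∀ j, x (p, j) = 0) → (∀ j, x (q, j) = 0) → x = 0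
  · obtain ⟨p, q, hpq, hG⟩ := hG
    have hz := rows_eq_zero_of_detecting_pair W hW h8 hpq hG
    obtain ⟨a, b, hab, hap, haq, hbp, hbq⟩ := hother p q hpq
    exact Or.inl ⟨a, b, hab, fun x hx j => ⟨hz x hx a hap haq j, hz x hx b hbp hbq j⟩⟩
  by_cases hG' : ∃ p q : Fin 4, p ≠ q ∧ ∀ y ∈ W', (∀ j, y (p, j) = 0) → (∀ j, y (q, j) = 0) → y = 0
  · obtain ⟨p, q, hpq, hG'⟩ := hG'
    have hz := rows_eq_zero_of_detecting_pair W' hW' h8' hpq hG'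
    obtain ⟨a, b, hab, hap, haq, hbp, hbq⟩ := hother p q hpq
    refine Or.inr ⟨a, b, hab, fun x hx i => ?_⟩
    exact ⟨hz (τ x) (memW' x hx) a hap haq i, hz (τ x) (memW' x hx) b hbp hbq i⟩
  exfalso
  -- no detecting pair on either side: all profiles are `(2,2,2,2)`
  have hd : ∀ e : Equiv.Perm (Fin 4), _ := fun e =>
    (filtration_dichotomy W hW h8 e).resolve_left hG
  have hd' : ∀ e : Equiv.Perm (Fin 4), _ := fun e =>
    (filtration_dichotomy W' hW' h8' e).resolve_left hG'
  -- the four rotations `e_k = (k, k+1, k+2, k+3)`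
  let σ : Fin 4 → Equiv.Perm (Fin 4) := fun k => (finRotate 4) ^ (k : ℕ)
  have hσ0 : ∀ k, σ k 0 = k := by decide
  have hσ3 : ∀ k, σ (k + 1) 3 = k := by decide
  -- row data for `W`
  have hR : ∀ l : Fin 4, finrank K ↥(W.map (LinearMap.funLeft K K fun j : Fin 4 => (l, j))) = 2 :=
    fun l => by have h := (hd (σ (l + 1))).2; rwa [hσ3] at h
  have hrow : ∀ x ∈ W, ∀ l : Fin 4, (fun p : Fin 4 × Fin 4 => if p.1 = l then x p else 0) ∈ W := by
    intro x hx l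
    have h := rowPiece_mem_of_finrank W h8 (σ l) (hd (σ l)).1 (by rw [hσ0]; exact hR l) x hx
    simpa only [hσ0] using h
  -- column data for `W`, from the row data of `W'`
  have hR' : ∀ l : Fin 4, finrank K ↥(W'.map (LinearMap.funLeft K K fun j : Fin 4 => (l, j))) = 2 :=
    fun l => by have h := (hd' (σ (l + 1))).2; rwa [hσ3] at h
  have hrow' : ∀ y ∈ W', ∀ l : Fin 4, (fun p : Fin 4 × Fin 4 => if p.1 = l then y p else 0) ∈ W' := by
    intro y hy l
    have h := rowPiece_mem_of_finrank W' h8' (σ l) (hd' (σ l)).1 (by rw [hσ0]; exact hR' l) y hy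
    simpa only [hσ0] using h
  have hcol : ∀ x ∈ W, ∀ j : Fin 4, (fun p : Fin 4 × Fin 4 => if p.2 = j then x p else 0) ∈ W := by
    intro x hx j
    have h := memW'' _ (hrow' (τ x) (memW' x hx) j)
    have heq : τ.symm (fun p : Fin 4 × Fin 4 => if p.1 = j then τ x p else 0) =
        fun p : Fin 4 × Fin 4 => if p.2 = j then x p else 0 := by
      apply τ.injective
      rw [LinearEquiv.apply_symm_apply]
      funext ⟨i, j'⟩
      simp only [hτa]
    rwa [heq] at h
  have hC : ∀ j : Fin 4, finrank K ↥(W.map (LinearMap.funLeft K K fun i : Fin 4 => (i, j))) = 2 := by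
    intro j
    have hmap : W.map (LinearMap.funLeft K K fun i : Fin 4 => (i, j)) =
        W'.map (LinearMap.funLeft K K fun j' : Fin 4 => (j, j')) := by
      rw [hW'def, ← Submodule.map_comp]
      rfl
    rw [hmap]
    exact hR' j
  exact false_of_row_col_stable W hW hrow hcol (fun l => (hR l).ge) (fun j => (hC j).ge)

/-- **The BoxFour equality case**, with the hypothesis in the form of the sixteen `3 × 3`
subpermanents (rows `≠ r`, columns `≠ c`), as produced by `eval_pderiv_perPoly_eq_permanent_submatrix`:
an `8`-dimensional linear subspace of `Sing Z(per_4)` is `{rows a, b zero}` or `{columns a, b zero}`.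
[folklore] -/
theorem two_rows_or_two_cols_of_subperm_three_vanish [CharZero K]
    (W : Submodule K (Fin 4 × Fin 4 → K))
    (hW : ∀ x ∈ W, ∀ r c : Fin 4,
      ((Matrix.of fun i j => x (i, j)).submatrix r.succAbove c.succAbove).permanent = 0)
    (h8 : finrank K W = 8) :
    (∃ a b : Fin 4, a ≠ b ∧ ∀ x ∈ W, ∀ j, x (a, j) = 0 ∧ x (b, j) = 0) ∨
    (∃ a b : Fin 4, a ≠ b ∧ ∀ x ∈ W, ∀ i, x (i, a) = 0 ∧ x (i, b) = 0) :=
  two_rows_or_two_cols W (fun x hx r c hr hc =>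
    subperm_vanish_inj_of_succAbove x (hW x hx) r c hr hc) h8

end Summit.ValiantsHypothesis.ValiantsHypothesis.Theorems.SymPencilBoxFourEquality

end
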